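import Summits.QuantumAdvantage.QuantumAdvantage.Theorems.WhiteBoxWalkWbwObfuscatedGluedTreesPrfHybrid
import Summits.QuantumAdvantage.QuantumAdvantage.Theorems.WbwObfuscatedGluedTreesKowPhReparam

/-!
# Line `knowledge-of-walk-split`, STAGE 7 ∘ 7B(b) corollary — black-box clause (C) from pseudorandomness of the four-key
# product of `P` AT ITS OWN PARAMETER (crux `WbwObfuscatedGluedTrees`, stmt-QuantumAdvantage-2340, route WhiteBoxWalk;
# lead prover-line-stmt-QuantumAdvantage-2340-c6-0)

Stage 7 (`prfHybridSoundness_holds`, p163315) derives `BlackBoxClauseC Λ P` from `SchedPRF Λ P` — pseudorandomness of the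
scheduled product ensemble, indexed by the SEED LENGTH.  The reparametrisation stub `reparam_schedPRF` (stage 7B(b),
p163663) supplies `SchedPRF Λ P` from pseudorandomness of the four-key product of `P.eval` at `P`'s own parameter
(adversaries polynomial in `μ`) when the schedule `μ = Λ.prfParam n` is `FP`, strictly increasing and polynomially honest
and the key parts have the PRF's key length.  This file records the composite: the only PRF hypothesis left is on `P` at
its own parameter (the multi-instance step from ONE instance, stage 7B(a), remains).
-/

set_option linter.dupNamespace false

noncomputable section

namespace Summit.QuantumAdvantage.QuantumAdvantage.Cruxes.WbwObfuscatedGluedTrees.KnowledgeOfWalkSplit.PrfHybrid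

open Literature.Computability.Complexity Literature.Computability.QuantumComplexity
open Literature.Computability.Cryptography Literature.Computability.Cryptography.ObfuscatedGluedTrees
open Summit.QuantumAdvantage.QuantumAdvantage.Theorems.WbwObfuscatedGluedTrees.KnowledgeOfWalk.RealIdeal
open Summit.QuantumAdvantage.QuantumAdvantage.Theorems.WbwObfuscatedGluedTrees.KnowledgeOfWalk.PrfHybrid
open Literature.Computability.Complexity.CodeFP (unE)
open _root_.Computability Filter Asymptotics

/-- **Black-box clause (C) for the landed generator from pseudorandomness of the four-key product of `P` at its own
parameter** (registered helper stub of crux stmt-QuantumAdvantage-2340): `IsPRF (m, k₀k₁k₂k₃, i·x ↦ F_{kᵢ}(x)) (4·keyLen)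
(m+2) m`, key parts of the PRF's key length, an `FP`, strictly increasing, polynomially honest and polynomially bounded
PRF schedule, an `FP` polynomially bounded depth schedule eventually above `n^ε`, eventually no truncation / domain
separation and a negligible tag gap give `BlackBoxClauseC Λ P` (stage 7 (ii) ∘ stage 7B(b)). -/
theorem blackBoxClauseC_of_prod4PRF :
    ∀ (Λ : Params) (P : PuncturablePRFScheme), (∀ n, Λ.keyPartLen n = P.keyLen (Λ.prfParam n)) →
      CodeFP unE unE Λ.prfParam → CodeFP unE unE Λ.depth → StrictMono Λ.prfParam →
      (∃ p : Polynomial ℕ, ∀ n, n ≤ p.eval (Λ.prfParam n)) →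
      (∃ p : Polynomial ℕ, ∀ n, Λ.prfParam n ≤ p.eval n ∧ Λ.depth n ≤ p.eval n) →
      IsPRF (fun m K z => P.eval m ((K.drop ((keyIdx z).val * P.keyLen m)).take (P.keyLen m)) (z.drop 2))
        (fun m => 4 * P.keyLen m) (fun m => m + 2) (fun m => m) →
      ∀ {ε : ℝ}, 0 < ε → (∀ᶠ n : ℕ in Filter.atTop, (n : ℝ) ^ ε ≤ Λ.depth n) →
        (∀ᶠ n : ℕ in Filter.atTop, labelLen (Λ.depth n) ≤ Λ.prfParam n ∧ Λ.depth n + 8 ≤ Λ.prfParam n) →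
        Asymptotics.SuperpolynomialDecay Filter.atTop (fun n : ℕ => (n : ℝ))
          (fun n => (2 : ℝ) ^ (2 * Λ.depth n + 4) / 2 ^ Λ.prfParam n) →
        BlackBoxClauseC Λ P :=
  fun Λ P hk hμFP hdFP hmono hlow hpoly hPRF _ hε hdep hμ hgap =>
    (prfHybridSoundness_holds Λ P hμFP hdFP hpoly).2 (reparam_schedPRF Λ P hk hμFP hmono hlow hPRF) ⟨_, hε, hdep⟩ hμ hgap

end Summit.QuantumAdvantage.QuantumAdvantage.Cruxes.WbwObfuscatedGluedTrees.KnowledgeOfWalkSplit.PrfHybrid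

end
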